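import Literature.MathematicalPhysics.QuantumManyBody.OneCoordinateMarginalLimit
import Literature.MathematicalPhysics.QuantumManyBody.OneCoordinateMarginalMultiplier
import Literature.MathematicalPhysics.QuantumManyBody.BoseGasTrialStateCompactness
import Summits.AtomisticToContinuum.BoseEinsteinCondensation.Theorems.BECTangentRigidityRigidMomentumBoundStubEnergyCauchy
import Summits.AtomisticToContinuum.BoseEinsteinCondensation.Theorems.BECTangentRigidityRigidMomentumBoundStubSlicePackageFinite
import HarnessLib

/-!
# Crux `RigidMomentumBound`, line `registered`: stub G4x `stub_marginalLimitExtraction`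

The limit extraction of the marginal limit package (G4) from the `L¹`-stability of slice data in
the energy norm (G4b, hypothesis) together with the LANDED energy-Cauchy property of near-minimisers
(G4a, `stub_energyCauchy`) and finite-`k` slice package (G4c, `stub_slicePackageFinite`): take a minimising sequence of the Dirichlet problem in `Λ_L^{n+1}`, pass to a
Rellich subsequence (`BoxFace.exists_subseq_tendsto_of_trialStates`, `L²`-convergent), so that by
(G4a) the states are Cauchy in the energy norm and by (G4b) their one-coordinate slice data are
Cauchy in `L¹(0,L)` with an explicit modulus; the limits and their properties are then supplied by
`Literature.MathematicalPhysics.QuantumManyBody.BoseGas.exists_sliceLimit_of_sequence`.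
-/

noncomputable section

namespace Summit.AtomisticToContinuum.BoseEinsteinCondensation.Theorems.RigidMomentumBound

open MeasureTheory Filter Set
open scoped ENNReal NNReal BigOperators Topology
open Literature.MathematicalPhysics.QuantumManyBody.BoseGas

namespace MarginalLimitExtraction

/-- Near-minimisers exist at every positive slack when `E₀ < ∞`. -/
theorem exists_nearMin {v : ℝ → ℝ≥0∞} {N : ℕ} {L : ℝ} (hfin : groundStateEnergy v N L ≠ ⊤)
    {θ : ℝ} (hθ : 0 < θ) :
    ∃ Φ : TrialState N L, energy v Φ ≤ groundStateEnergy v N L + ENNReal.ofReal θ := by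
  have hlt : groundStateEnergy v N L < groundStateEnergy v N L + ENNReal.ofReal θ :=
    ENNReal.lt_add_right hfin (by simpa using hθ)
  obtain ⟨Φ, hΦ⟩ := iInf_lt_iff.1 (show (⨅ Ψ : TrialState N L, energy v Ψ) < _ from hlt)
  exact ⟨Φ, hΦ.le⟩

/-- The Cauchy modulus bookkeeping: if `q ≤ E (rₖ + rₗ)² + 4(δₖ + δₗ)` then
`√q ≤ bₖ + bₗ` with `bₖ = √(2 E rₖ² + 4 δₖ)`. -/
theorem sqrt_le_modulus {E q rk rl dk dl : ℝ} (hE : 0 ≤ E) (hdk : 0 ≤ dk) (hdl : 0 ≤ dl)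
    (hq : q ≤ E * (rk + rl) ^ 2 + 4 * (dk + dl)) :
    Real.sqrt q ≤ Real.sqrt (2 * E * rk ^ 2 + 4 * dk) + Real.sqrt (2 * E * rl ^ 2 + 4 * dl) := by
  have h1 : q ≤ (2 * E * rk ^ 2 + 4 * dk) + (2 * E * rl ^ 2 + 4 * dl) := by
    nlinarith [sq_nonneg (rk - rl)]
  -- `√(x + y) ≤ √x + √y` (inlined)
  have hsum : ∀ {x y : ℝ}, 0 ≤ x → 0 ≤ y → Real.sqrt (x + y) ≤ Real.sqrt x + Real.sqrt y := by
    intro x y hx hy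
    have h : x + y ≤ (Real.sqrt x + Real.sqrt y) ^ 2 := by
      nlinarith [Real.sq_sqrt hx, Real.sq_sqrt hy, Real.sqrt_nonneg x, Real.sqrt_nonneg y]
    calc Real.sqrt (x + y) ≤ Real.sqrt ((Real.sqrt x + Real.sqrt y) ^ 2) := Real.sqrt_le_sqrt h
      _ = Real.sqrt x + Real.sqrt y := Real.sqrt_sq (by positivity)
  exact (Real.sqrt_le_sqrt h1).trans (hsum (by positivity) (by positivity))

/-- The mass of a difference is the square of the `L²` distance. -/
theorem lintegral_nnnorm_sub_sq_eq {N : ℕ} (φ ψ : Config N → ℂ) :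
    (∫⁻ X, (‖φ X - ψ X‖₊ : ℝ≥0∞) ^ 2) = eLpNorm (φ - ψ) 2 volume ^ 2 := by
  have := BoxFace.setLIntegral_enorm_sq_eq (φ - ψ) Set.univ
  rw [Measure.restrict_univ] at this
  rw [← this]
  simp [enorm_eq_nnnorm]

end MarginalLimitExtraction

/-- **G4x `stub_marginalLimitExtraction`** (lead). The marginal limit package from slice stability
(G4b), using the landed energy-Cauchy property (G4a) and finite-`k` slice package (G4c), via a
Rellich subsequence of a minimising sequence and `exists_sliceLimit_of_sequence`. -/
theorem stub_marginalLimitExtraction :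
    (
      ∀ (v : ℝ → ℝ≥0∞), Measurable v → ∀ {N : ℕ} {L : ℝ}, 0 < L → ∀ (Φ Ψ : TrialState N L)
        (p : Fin N × Fin 3), energy v Φ ≠ ⊤ → energy v Ψ ≠ ⊤ →
        (∫⁻ X, (kineticDensity (fun X => Φ.ψ X - Ψ.ψ X) X +
            interaction v X * (‖Φ.ψ X - Ψ.ψ X‖₊ : ℝ≥0∞) ^ 2)) ≠ ⊤ →
        (∫ t in (0 : ℝ)..L, |sliceEnergyReal v Φ.ψ p t - sliceEnergyReal v Ψ.ψ p t|) ≤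
            Real.sqrt (∫⁻ X, (kineticDensity (fun X => Φ.ψ X - Ψ.ψ X) X +
                interaction v X * (‖Φ.ψ X - Ψ.ψ X‖₊ : ℝ≥0∞) ^ 2)).toReal *
              Real.sqrt (2 * ((energy v Φ).toReal + (energy v Ψ).toReal)) ∧
        (∫ t in (0 : ℝ)..L, |normalSliceEnergyReal Φ.ψ p t - normalSliceEnergyReal Ψ.ψ p t|) ≤
            Real.sqrt (∫⁻ X, (kineticDensity (fun X => Φ.ψ X - Ψ.ψ X) X +
                interaction v X * (‖Φ.ψ X - Ψ.ψ X‖₊ : ℝ≥0∞) ^ 2)).toReal *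
              Real.sqrt (2 * ((energy v Φ).toReal + (energy v Ψ).toReal)) ∧
        (∫ t in (0 : ℝ)..L, |sliceCurrent Φ.ψ p t - sliceCurrent Ψ.ψ p t|) ≤
            Real.sqrt (∫⁻ X, (‖Φ.ψ X - Ψ.ψ X‖₊ : ℝ≥0∞) ^ 2).toReal * Real.sqrt (energy v Φ).toReal +
              Real.sqrt (∫⁻ X, (kineticDensity (fun X => Φ.ψ X - Ψ.ψ X) X +
                interaction v X * (‖Φ.ψ X - Ψ.ψ X‖₊ : ℝ≥0∞) ^ 2)).toReal) →
    (
      ∀ (v : ℝ → ℝ≥0∞), Measurable v → ∀ (n : ℕ) (L : ℝ), 0 < L →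
        groundStateEnergy v (n + 1) L ≠ ⊤ → groundStateEnergy v n L ≠ ⊤ →
        ∃ (m p et e : Fin 3 → ℝ → ℝ),
          (∀ a : Fin 3,
            ContinuousOn (m a) (Set.Icc 0 L) ∧ m a 0 = 0 ∧ (∀ s ∈ Set.Icc 0 L, 0 ≤ m a s) ∧
            IntegrableOn (p a) (Set.Icc 0 L) ∧ IntegrableOn (et a) (Set.Icc 0 L) ∧
            IntegrableOn (e a) (Set.Icc 0 L) ∧
            (∀ s ∈ Set.Icc 0 L, m a s = ∫ x in (0 : ℝ)..s, p a x) ∧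
            (∀ᵐ s ∂(volume.restrict (Set.Icc 0 L)),
              0 ≤ et a s ∧ et a s ≤ e a s ∧ p a s ^ 2 ≤ 4 * m a s * et a s) ∧
            (∀ g : ℝ → ℝ, ContDiff ℝ 1 g →
              (∫ s in (0 : ℝ)..L, g s * e a s) + (1 / 2) * (∫ s in (0 : ℝ)..L, deriv g s * p a s) =
                (groundStateEnergy v (n + 1) L).toReal * ∫ s in (0 : ℝ)..L, g s * m a s) ∧
            (∀ g : ℝ → ℝ, ContDiff ℝ 1 g → (∀ s, 0 ≤ g s) →
              (∫ s in (0 : ℝ)..L, g s * et a s) +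
                  (groundStateEnergy v n L).toReal * (∫ s in (0 : ℝ)..L, g s * m a s) ≤
                ∫ s in (0 : ℝ)..L, g s * e a s) ∧
            (∀ b ∈ Set.Icc 0 L, ∀ K : ℝ,
              (∀ Φ : TrialState (n + 1) L, energy v Φ ≤ groundStateEnergy v (n + 1) L + 1 →
                (∫ s in (0 : ℝ)..b, marginalMassReal Φ.ψ ((0 : Fin (n + 1)), a) (L - s)) ≤ K) →
              (∫ s in (0 : ℝ)..b, m a s) ≤ K)) ∧
          (∀ σ ∈ Set.Icc 0 L, ∀ θ : ℝ, 0 < θ → ∃ Φ : TrialState (n + 1) L,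
            energy v Φ ≤ groundStateEnergy v (n + 1) L + ENNReal.ofReal θ ∧
            ∀ a : Fin 3, (∫ s in (0 : ℝ)..σ, sliceEnergyReal v Φ.ψ ((0 : Fin (n + 1)), a) (L - s)) ≤
              (∫ s in (0 : ℝ)..σ, e a s) + θ)) := by
  intro hB v hv n L hL hfin hfin0
  have hA := @stub_energyCauchy
  have hC := @stub_slicePackageFinite
  set E₀ : ℝ≥0∞ := groundStateEnergy v (n + 1) L with hE₀
  have hE₀r : 0 ≤ E₀.toReal := ENNReal.toReal_nonneg
  -- a minimising sequence and a Rellich subsequence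
  choose Φ hΦ using fun k : ℕ =>
    MarginalLimitExtraction.exists_nearMin (v := v) (N := n + 1) (L := L) hfin (θ := 1 / ((k : ℝ) + 1)) (by positivity)
  have hkin : ∀ k, ∫⁻ X, kineticDensity (Φ k).ψ X ≤ E₀ + 1 := fun k =>
    calc ∫⁻ X, kineticDensity (Φ k).ψ X ≤ energy v (Φ k) := lintegral_mono fun X => le_self_add
      _ ≤ E₀ + ENNReal.ofReal (1 / ((k : ℝ) + 1)) := hΦ k
      _ ≤ E₀ + 1 := add_le_add le_rfl (ENNReal.ofReal_le_one.2 (by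
          rw [div_le_one (by positivity)]; linarith [Nat.cast_nonneg (α := ℝ) k]))
  obtain ⟨f, κ, hκ, hf2, hL2, -⟩ := BoxFace.exists_subseq_tendsto_of_trialStates (N := n + 1)
    (fun _ : ℕ => L) (Lbar := L) (fun _ => hL.le) (fun _ => le_rfl) (fun k => Φ k) (K := E₀ + 1)
    (ENNReal.add_ne_top.2 ⟨hfin, ENNReal.one_ne_top⟩) hkin
  set Ψ : ℕ → TrialState (n + 1) L := fun k => Φ (κ k) with hΨ
  set δ : ℕ → ℝ := fun k => 1 / ((κ k : ℝ) + 1) with hδ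
  have hδpos : ∀ k, 0 < δ k := fun k => by positivity
  have hδ1 : ∀ k, δ k ≤ 1 := fun k => by
    rw [hδ]; dsimp only
    rw [div_le_one (by positivity)]; linarith [Nat.cast_nonneg (α := ℝ) (κ k)]
  have hδT : Tendsto δ atTop (𝓝 0) := tendsto_one_div_add_atTop_nhds_zero_nat.comp hκ.tendsto_atTop
  have hΨE : ∀ k, energy v (Ψ k) ≤ E₀ + ENNReal.ofReal (δ k) := fun k => hΦ (κ k)
  have htop : ∀ k, E₀ + ENNReal.ofReal (δ k) ≠ ⊤ := fun k =>
    ENNReal.add_ne_top.2 ⟨hfin, ENNReal.ofReal_ne_top⟩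
  have hΨfin : ∀ k, energy v (Ψ k) ≠ ⊤ := fun k => ne_top_of_le_ne_top (htop k) (hΨE k)
  have hΨEr : ∀ k, (energy v (Ψ k)).toReal ≤ E₀.toReal + δ k := fun k => by
    have := ENNReal.toReal_mono (htop k) (hΨE k)
    rwa [ENNReal.toReal_add hfin ENNReal.ofReal_ne_top, ENNReal.toReal_ofReal (hδpos k).le] at this
  have hΨEr1 : ∀ k, (energy v (Ψ k)).toReal ≤ E₀.toReal + 1 := fun k => (hΨEr k).trans (by linarith [hδ1 k])
  have hΨEr' : ∀ k, E₀.toReal ≤ (energy v (Ψ k)).toReal := fun k =>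
    ENNReal.toReal_mono (hΨfin k) (iInf_le (fun Ψ : TrialState (n + 1) L => energy v Ψ) (Ψ k))
  have hεT : Tendsto (fun k => (energy v (Ψ k)).toReal) atTop (𝓝 E₀.toReal) := by
    refine tendsto_of_tendsto_of_tendsto_of_le_of_le tendsto_const_nhds ?_ hΨEr' hΨEr
    simpa using (tendsto_const_nhds (x := E₀.toReal)).add hδT
  have hE1 : ∀ k, energy v (Ψ k) ≤ groundStateEnergy v (n + 1) L + 1 := fun k =>
    (hΨE k).trans (add_le_add le_rfl (ENNReal.ofReal_le_one.2 (hδ1 k)))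
  -- `L²` distances
  have hΨmem : ∀ k, MemLp (Ψ k).ψ 2 volume := fun k =>
    (Ψ k).contDiff.continuous.memLp_of_hasCompactSupport (TrialState.hasCompactSupport' _)
  have hdfin : ∀ k, eLpNorm ((Ψ k).ψ - f) 2 volume < ⊤ := fun k => ((hΨmem k).sub hf2).eLpNorm_lt_top
  set r : ℕ → ℝ := fun k => (eLpNorm ((Ψ k).ψ - f) 2 volume).toReal with hr
  have hr0 : ∀ k, 0 ≤ r k := fun k => ENNReal.toReal_nonneg
  have hrT : Tendsto r atTop (𝓝 0) := by
    have := (ENNReal.tendsto_toReal ENNReal.zero_ne_top).comp hL2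
    rw [ENNReal.toReal_zero] at this
    exact this
  have hkl2 : ∀ k l, eLpNorm ((Ψ k).ψ - (Ψ l).ψ) 2 volume ≤ ENNReal.ofReal (r k + r l) := fun k l => by
    have h := eLpNorm_sub_le ((hΨmem k).sub hf2).1 ((hΨmem l).sub hf2).1 (p := 2) (μ := volume)
      (by norm_num)
    have heq : (Ψ k).ψ - f - ((Ψ l).ψ - f) = (Ψ k).ψ - (Ψ l).ψ := by abel
    rw [heq] at h
    refine h.trans ?_
    rw [ENNReal.ofReal_add (hr0 k) (hr0 l), hr]
    dsimp only
    rw [ENNReal.ofReal_toReal (hdfin k).ne, ENNReal.ofReal_toReal (hdfin l).ne]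
  have hmass : ∀ k l, (∫⁻ X, (‖(Ψ k).ψ X - (Ψ l).ψ X‖₊ : ℝ≥0∞) ^ 2) ≤ ENNReal.ofReal ((r k + r l) ^ 2) :=
    fun k l => by
    rw [MarginalLimitExtraction.lintegral_nnnorm_sub_sq_eq, ENNReal.ofReal_pow (add_nonneg (hr0 k) (hr0 l))]
    exact pow_le_pow_left₀ bot_le (hkl2 k l) 2
  have hmass_fin : ∀ k l, (∫⁻ X, (‖(Ψ k).ψ X - (Ψ l).ψ X‖₊ : ℝ≥0∞) ^ 2) ≠ ⊤ := fun k l =>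
    ne_top_of_le_ne_top ENNReal.ofReal_ne_top (hmass k l)
  have hmassr : ∀ k l, (∫⁻ X, (‖(Ψ k).ψ X - (Ψ l).ψ X‖₊ : ℝ≥0∞) ^ 2).toReal ≤ (r k + r l) ^ 2 :=
    fun k l => by
    have := ENNReal.toReal_mono ENNReal.ofReal_ne_top (hmass k l)
    rwa [ENNReal.toReal_ofReal (by positivity)] at this
  -- energy-Cauchy (G4a)
  have hQ : ∀ k l, (∫⁻ X, (kineticDensity (fun X => (Ψ k).ψ X - (Ψ l).ψ X) X +
      interaction v X * (‖(Ψ k).ψ X - (Ψ l).ψ X‖₊ : ℝ≥0∞) ^ 2)) ≤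
        E₀ * (∫⁻ X, (‖(Ψ k).ψ X - (Ψ l).ψ X‖₊ : ℝ≥0∞) ^ 2) + ENNReal.ofReal (4 * (δ k + δ l)) :=
    fun k l => hA v hv (Ψ k) (Ψ l) (δ k + δ l) (by linarith [hδpos k, hδpos l]) hfin
      ((hΨE k).trans (add_le_add le_rfl (ENNReal.ofReal_le_ofReal (by linarith [hδpos l]))))
      ((hΨE l).trans (add_le_add le_rfl (ENNReal.ofReal_le_ofReal (by linarith [hδpos k]))))
  have hQfin : ∀ k l, (∫⁻ X, (kineticDensity (fun X => (Ψ k).ψ X - (Ψ l).ψ X) X +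
      interaction v X * (‖(Ψ k).ψ X - (Ψ l).ψ X‖₊ : ℝ≥0∞) ^ 2)) ≠ ⊤ := fun k l =>
    ne_top_of_le_ne_top (ENNReal.add_ne_top.2 ⟨ENNReal.mul_ne_top hfin (hmass_fin k l),
      ENNReal.ofReal_ne_top⟩) (hQ k l)
  have hQr : ∀ k l, (∫⁻ X, (kineticDensity (fun X => (Ψ k).ψ X - (Ψ l).ψ X) X +
      interaction v X * (‖(Ψ k).ψ X - (Ψ l).ψ X‖₊ : ℝ≥0∞) ^ 2)).toReal ≤
        E₀.toReal * (r k + r l) ^ 2 + 4 * (δ k + δ l) := fun k l => by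
    have := ENNReal.toReal_mono (ENNReal.add_ne_top.2 ⟨ENNReal.mul_ne_top hfin (hmass_fin k l),
      ENNReal.ofReal_ne_top⟩) (hQ k l)
    rw [ENNReal.toReal_add (ENNReal.mul_ne_top hfin (hmass_fin k l)) ENNReal.ofReal_ne_top,
      ENNReal.toReal_mul, ENNReal.toReal_ofReal (by linarith [hδpos k, hδpos l])] at this
    refine this.trans (add_le_add (mul_le_mul_of_nonneg_left (hmassr k l) hE₀r) le_rfl)
  -- the Cauchy modulus
  set b : ℕ → ℝ := fun k => Real.sqrt (2 * E₀.toReal * r k ^ 2 + 4 * δ k) with hb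
  set c₁ : ℝ := Real.sqrt (2 * ((E₀.toReal + 1) + (E₀.toReal + 1))) with hc₁
  set c₂ : ℝ := Real.sqrt (E₀.toReal + 1) with hc₂
  set β : ℕ → ℝ := fun k => c₁ * b k + 2 * (c₂ * r k + b k) with hβ
  have hb0 : ∀ k, 0 ≤ b k := fun k => Real.sqrt_nonneg _
  have hc₁0 : 0 ≤ c₁ := Real.sqrt_nonneg _
  have hc₂0 : 0 ≤ c₂ := Real.sqrt_nonneg _
  have hbT : Tendsto b atTop (𝓝 0) := by
    have h1 : Tendsto (fun k => 2 * E₀.toReal * r k ^ 2 + 4 * δ k) atTop (𝓝 0) := by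
      simpa using ((hrT.pow 2).const_mul (2 * E₀.toReal)).add (hδT.const_mul 4)
    have := (Real.continuous_sqrt.tendsto 0).comp h1
    rwa [Real.sqrt_zero] at this
  have hβT : Tendsto β atTop (𝓝 0) := by
    simpa using (hbT.const_mul c₁).add (((hrT.const_mul c₂).add hbT).const_mul 2)
  have hsqQ : ∀ k l, Real.sqrt (∫⁻ X, (kineticDensity (fun X => (Ψ k).ψ X - (Ψ l).ψ X) X +
      interaction v X * (‖(Ψ k).ψ X - (Ψ l).ψ X‖₊ : ℝ≥0∞) ^ 2)).toReal ≤ b k + b l := fun k l =>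
    MarginalLimitExtraction.sqrt_le_modulus hE₀r (hδpos k).le (hδpos l).le (hQr k l)
  have hsqE : ∀ k l, Real.sqrt (2 * ((energy v (Ψ k)).toReal + (energy v (Ψ l)).toReal)) ≤ c₁ :=
    fun k l => Real.sqrt_le_sqrt (by linarith [hΨEr1 k, hΨEr1 l])
  have hsqM : ∀ k l, Real.sqrt (∫⁻ X, (‖(Ψ k).ψ X - (Ψ l).ψ X‖₊ : ℝ≥0∞) ^ 2).toReal ≤ r k + r l :=
    fun k l => by
    calc Real.sqrt (∫⁻ X, (‖(Ψ k).ψ X - (Ψ l).ψ X‖₊ : ℝ≥0∞) ^ 2).toReal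
        ≤ Real.sqrt ((r k + r l) ^ 2) := Real.sqrt_le_sqrt (hmassr k l)
      _ = r k + r l := Real.sqrt_sq (add_nonneg (hr0 k) (hr0 l))
  have hsqEk : ∀ k, Real.sqrt (energy v (Ψ k)).toReal ≤ c₂ := fun k => Real.sqrt_le_sqrt (hΨEr1 k)
  -- the per-direction limits
  have key : ∀ a : Fin 3, _ := fun a => by
    have hBa : ∀ k l, _ := fun k l => hB v hv hL (Ψ k) (Ψ l) ((0 : Fin (n + 1)), a) (hΨfin k)
      (hΨfin l) (hQfin k l)
    have hCa : ∀ k, _ := fun k => hC v hv n L hL (Ψ k) (hΨfin k) a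
    refine exists_sliceLimit_of_sequence (v := v) hL Ψ a E₀.toReal (groundStateEnergy v n L).toReal
      (3 * (E₀.toReal + 1) + 2) (fun k => (energy v (Ψ k)).toReal) δ β hεT hδT hβT
      (fun k => (hCa k).1) (fun k => (hCa k).2.2.1) (fun k => (hCa k).2.2.2.1)
      (fun k => (hCa k).2.2.2.2.1) (fun k => (hCa k).2.2.2.2.2.1) (fun k => (hCa k).2.2.2.2.2.2.1)
      (fun k => (hCa k).2.2.2.2.2.2.2.1) (fun k => (hCa k).2.2.2.2.2.2.2.2.1) (fun k g hg hg1 D hD hgD => ?_)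
      (fun k g hg hg0 hg1 => (hCa k).2.2.2.2.2.2.2.2.2.2 g hg hg0 hg1) (fun k l => ?_) (fun k l => ?_)
      (fun k l => ?_)
    · -- approximate virial identity with the simplified error
      have h := (hCa k).2.2.2.2.2.2.2.2.2.1 g hg hg1 D hD hgD (δ k) (hδpos k) (hΨE k)
      refine h.trans (add_le_add (mul_le_mul_of_nonneg_left ?_ (Real.sqrt_nonneg _)) le_rfl)
      nlinarith [hΨEr1 k, hδ1 k]
    · -- momentum distance
      have h := (hBa k l).2.2
      have hconv := setIntegral_Ioc_abs_comp_sub_left hL.le (fun t =>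
        sliceCurrent (Ψ k).ψ ((0 : Fin (n + 1)), a) t - sliceCurrent (Ψ l).ψ ((0 : Fin (n + 1)), a) t)
      have h2 : ∫ s in Ioc 0 L, |(-2 * sliceCurrent (Ψ k).ψ ((0 : Fin (n + 1)), a) (L - s)) -
          (-2 * sliceCurrent (Ψ l).ψ ((0 : Fin (n + 1)), a) (L - s))| =
          2 * ∫ t in (0:ℝ)..L, |sliceCurrent (Ψ k).ψ ((0 : Fin (n + 1)), a) t -
            sliceCurrent (Ψ l).ψ ((0 : Fin (n + 1)), a) t| := by
        rw [← hconv, ← integral_const_mul]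
        refine integral_congr_ae (Eventually.of_forall fun s => ?_)
        dsimp only
        rw [show -2 * sliceCurrent (Ψ k).ψ (0, a) (L - s) - -2 * sliceCurrent (Ψ l).ψ (0, a) (L - s) =
          (-2) * (sliceCurrent (Ψ k).ψ (0, a) (L - s) - sliceCurrent (Ψ l).ψ (0, a) (L - s)) by ring,
          abs_mul]
        norm_num
      rw [h2]
      have := (hsqM k l)
      have := hsqEk k
      have := hsqQ k l
      have hmul : Real.sqrt (∫⁻ X, (‖(Ψ k).ψ X - (Ψ l).ψ X‖₊ : ℝ≥0∞) ^ 2).toReal *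
          Real.sqrt (energy v (Ψ k)).toReal ≤ (r k + r l) * c₂ :=
        mul_le_mul (hsqM k l) (hsqEk k) (Real.sqrt_nonneg _) (add_nonneg (hr0 k) (hr0 l))
      rw [hβ]; dsimp only
      nlinarith [h, hmul, hb0 k, hb0 l, hc₁0, mul_nonneg hc₁0 (hb0 k), mul_nonneg hc₁0 (hb0 l)]
    · -- normal slice energy distance
      have h := (hBa k l).2.1
      rw [setIntegral_Ioc_abs_comp_sub_left hL.le (fun t =>
        normalSliceEnergyReal (Ψ k).ψ ((0 : Fin (n + 1)), a) t -
          normalSliceEnergyReal (Ψ l).ψ ((0 : Fin (n + 1)), a) t)]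
      have hmul : Real.sqrt (∫⁻ X, (kineticDensity (fun X => (Ψ k).ψ X - (Ψ l).ψ X) X +
          interaction v X * (‖(Ψ k).ψ X - (Ψ l).ψ X‖₊ : ℝ≥0∞) ^ 2)).toReal *
          Real.sqrt (2 * ((energy v (Ψ k)).toReal + (energy v (Ψ l)).toReal)) ≤ (b k + b l) * c₁ :=
        mul_le_mul (hsqQ k l) (hsqE k l) (Real.sqrt_nonneg _) (add_nonneg (hb0 k) (hb0 l))
      rw [hβ]; dsimp only
      nlinarith [h, hmul, hb0 k, hb0 l, hr0 k, hr0 l, hc₂0, mul_nonneg hc₂0 (hr0 k),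
        mul_nonneg hc₂0 (hr0 l)]
    · -- full slice energy distance
      have h := (hBa k l).1
      rw [setIntegral_Ioc_abs_comp_sub_left hL.le (fun t =>
        sliceEnergyReal v (Ψ k).ψ ((0 : Fin (n + 1)), a) t - sliceEnergyReal v (Ψ l).ψ ((0 : Fin (n + 1)), a) t)]
      have hmul : Real.sqrt (∫⁻ X, (kineticDensity (fun X => (Ψ k).ψ X - (Ψ l).ψ X) X +
          interaction v X * (‖(Ψ k).ψ X - (Ψ l).ψ X‖₊ : ℝ≥0∞) ^ 2)).toReal *
          Real.sqrt (2 * ((energy v (Ψ k)).toReal + (energy v (Ψ l)).toReal)) ≤ (b k + b l) * c₁ :=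
        mul_le_mul (hsqQ k l) (hsqE k l) (Real.sqrt_nonneg _) (add_nonneg (hb0 k) (hb0 l))
      rw [hβ]; dsimp only
      nlinarith [h, hmul, hb0 k, hb0 l, hr0 k, hr0 l, hc₂0, mul_nonneg hc₂0 (hr0 k),
        mul_nonneg hc₂0 (hr0 l)]
  choose m p et e hkey using key
  refine ⟨m, p, et, e, fun a => ?_, fun σ hσ θ hθ => ?_⟩
  · obtain ⟨h1, h2, h3, h4, h5, h6, h7, h8, h9, h10, h11, -, -, -⟩ := hkey a
    exact ⟨h1, h2, h3, h4, h5, h6, h7, h8, h9, h10, fun b hb K hK =>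
      le_of_tendsto' (h11 b hb) fun k => hK (Ψ k) (hE1 k)⟩
  · -- transfer of the slice energies back to a near-minimiser
    have ev1 : ∀ᶠ k in atTop, δ k ≤ θ := hδT.eventually (Iic_mem_nhds hθ)
    have ev2 : ∀ a : Fin 3, ∀ᶠ k in atTop,
        (∫ s in Ioc 0 L, |sliceEnergyReal v (Ψ k).ψ ((0 : Fin (n + 1)), a) (L - s) - e a s|) ≤ θ :=
      fun a => (hkey a).2.2.2.2.2.2.2.2.2.2.2.2.2.eventually (Iic_mem_nhds hθ)
    obtain ⟨k, hk1, hk2⟩ := (ev1.and (eventually_all.2 ev2)).exists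
    refine ⟨Ψ k, (hΨE k).trans (add_le_add le_rfl (ENNReal.ofReal_le_ofReal hk1)), fun a => ?_⟩
    obtain ⟨-, -, -, -, -, -, -, -, -, -, -, heO, hEO, -⟩ := hkey a
    have hEk : IntervalIntegrable (fun s => sliceEnergyReal v (Ψ k).ψ ((0 : Fin (n + 1)), a) (L - s))
        volume 0 σ :=
      (intervalIntegrable_iff_integrableOn_Ioc_of_le hσ.1).2 ((hEO k).mono_set (Ioc_subset_Ioc_right hσ.2))
    have hek : IntervalIntegrable (e a) volume 0 σ :=
      (intervalIntegrable_iff_integrableOn_Ioc_of_le hσ.1).2 (heO.mono_set (Ioc_subset_Ioc_right hσ.2))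
    have hsub := intervalIntegral.integral_sub hEk hek
    have hle : (∫ s in (0:ℝ)..σ, (sliceEnergyReal v (Ψ k).ψ ((0 : Fin (n + 1)), a) (L - s) - e a s)) ≤ θ := by
      rw [intervalIntegral.integral_of_le hσ.1]
      calc ∫ s in Ioc 0 σ, (sliceEnergyReal v (Ψ k).ψ ((0 : Fin (n + 1)), a) (L - s) - e a s)
          ≤ ∫ s in Ioc 0 σ, |sliceEnergyReal v (Ψ k).ψ ((0 : Fin (n + 1)), a) (L - s) - e a s| :=
            (le_abs_self _).trans abs_integral_le_integral_abs
        _ ≤ ∫ s in Ioc 0 L, |sliceEnergyReal v (Ψ k).ψ ((0 : Fin (n + 1)), a) (L - s) - e a s| :=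
            setIntegral_mono_set (((hEO k).sub heO).abs) (Eventually.of_forall fun s => abs_nonneg _)
              (Ioc_subset_Ioc_right hσ.2).eventuallyLE
        _ ≤ θ := hk2 a
    linarith

end Summit.AtomisticToContinuum.BoseEinsteinCondensation.Theorems.RigidMomentumBound

end
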